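import Mathlib

/-!
# Strip theorem, part H: the endgame arithmetic

Support file for crux item `stmt-MatrixMultiplication-10752`
(`Summit.MatrixMultiplication.MatrixMultiplication.Theses.HiddenToeplitzCorners.HiddenCornerLemmaR`),
line `frobenius-dual-short-syzygies`, stub `stub_gconstDualLaw` / the strip theorem
(paper proof `math/STRIP_THEOREM.md` §3 (E)).

This file isolates the final counting argument of the strip theorem (hidden `r`-corners of
`p`-strip Toeplitz-like pencils have `r ≤ 2p - 1`) from all linear algebra: it is a statement
about natural numbers only.  The strips `k : Fin p` have heights `w k ≥ 1` summing to `N`;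
`cap j` / `kap j` are the capacity and the Krylov dimension of the frame at window `j`;
a strip `k` is *junk* when `cap (w k) = 0`.  Hypotheses: (I) the capacity inequality
`r (cap j + j) ≤ 2 kap j` whenever `cap j > 0`; (Mono) junk is an up-set in `j`; (C) the `r`
targets fit into the capacities of the strips; (K) `kap j ≤ N`; (II) for every level `wstar`
below all junk strips, the junk rows `Σ_{junk k} (w k + 1 - wstar)` plus `kap wstar` fit into `N`.
Conclusion: `r ≤ 2p - 1`.

Proof.  The non-junk strips form a nonempty set `K'` (otherwise `Σ cap (w k) = 0 < r`); let
`wstar` be the largest height of a non-junk strip.  By (Mono) every junk strip is higher than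
`wstar`, so (II) applies at `wstar`, and (I) applies at `wstar` as well.  Splitting
`N = Σ_{junk} w k + Σ_{non-junk} w k`, using `Σ_{junk} (w k + 1 - wstar) + |J| wstar = Σ_{junk} w k + |J|`
and `Σ_{non-junk} w k ≤ |K'| wstar`, `|K'| + |J| = p`, one gets `kap wstar + |J| ≤ p wstar`, whence
`r (wstar + 1) ≤ 2 kap wstar ≤ 2 p wstar < 2 p (wstar + 1)` and `r < 2p`.
(Hypothesis (K) is not needed for this route; it is kept because it is part of the registered
interface.)  Folklore arithmetic; Mathlib only.
-/

set_option linter.dupNamespace false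

namespace Summit.MatrixMultiplication.MatrixMultiplication.Theorems

open scoped BigOperators

set_option linter.unusedVariables false in
/-- H1: the endgame of the strip theorem as a statement about natural numbers.
`w k` are the strip heights (sum `N`), `cap`/`kap` the capacity / Krylov-dimension profiles of the
frame, `r ≥ 2` the corner size.  Hypotheses: (I) capacity inequality, (Mono) junk is an up-set,
(C) the targets fit into the capacities, (K) Krylov dimensions are at most `N`, (II) the junk-row
count at any level `wstar` below every junk strip.  Conclusion: `r ≤ 2 p - 1`
(registered stub `hclR_strip_endgame`). -/
theorem hclR_strip_endgame : ∀ (p r N : ℕ) (w : Fin p → ℕ) (cap kap : ℕ → ℕ) (hr : 2 ≤ r) (hw : ∀ k, 1 ≤ w k) (hN : ∑ k, w k = N) (hI : ∀ j, 1 ≤ j → 0 < cap j → r * (cap j + j) ≤ 2 * kap j) (hMono : ∀ j j', j ≤ j' → cap j = 0 → cap j' = 0) (hC : r ≤ ∑ k, cap (w k)) (hK : ∀ j, kap j ≤ N) (hII : ∀ wstar : ℕ, (∀ k, cap (w k) = 0 → wstar ≤ w k) → (∑ k ∈ Finset.univ.filter (fun k => cap (w k) = 0), (w k + 1 - wstar))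 + kap wstar ≤ N), r ≤ 2 * p - 1 := by
  intro p r N w cap kap hr hw hN hI hMono hC _hK hII
  -- the junk strips `J` and the non-junk strips `K'`
  set J : Finset (Fin p) := Finset.univ.filter (fun k => cap (w k) = 0) with hJdef
  set K' : Finset (Fin p) := Finset.univ.filter (fun k => ¬ cap (w k) = 0) with hK'def
  have hmemJ : ∀ k, k ∈ J ↔ cap (w k) = 0 := fun k => by simp [hJdef]
  have hmemK' : ∀ k, k ∈ K' ↔ ¬ cap (w k) = 0 := fun k => by simp [hK'def]
  -- `K'` is nonempty: otherwise all capacities vanish, contradicting (C)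
  have hK'ne : K'.Nonempty := by
    by_contra h
    rw [Finset.not_nonempty_iff_eq_empty] at h
    have hzero : ∑ k, cap (w k) = 0 := by
      refine Finset.sum_eq_zero (fun k _ => ?_)
      by_contra hk
      have hk' : k ∈ K' := (hmemK' k).2 hk
      rw [h] at hk'
      simp at hk'
    omega
  -- the widest non-junk strip `k₀`, of height `ws`
  obtain ⟨k₀, hk₀K', hk₀max⟩ := Finset.exists_max_image K' w hK'ne
  set ws : ℕ := w k₀ with hws
  have hk₀ : ¬ cap ws = 0 := (hmemK' k₀).1 hk₀K'
  have hws1 : 1 ≤ ws := hw k₀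
  -- every junk strip is at least as high as `ws` (by (Mono))
  have hprem : ∀ k, cap (w k) = 0 → ws ≤ w k := by
    intro k hk
    by_contra hlt
    exact hk₀ (hMono (w k) ws (not_le.mp hlt).le hk)
  -- (I) at `ws` and (II) at `ws`
  have h1 : r * (cap ws + ws) ≤ 2 * kap ws := hI ws hws1 (Nat.pos_of_ne_zero hk₀)
  have h2 : (∑ k ∈ J, (w k + 1 - ws)) + kap ws ≤ N := hII ws hprem
  -- split `N` over junk / non-junk strips
  have hsplit : (∑ k ∈ J, w k) + ∑ k ∈ K', w k = N := by
    rw [← hN]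
    exact Finset.sum_filter_add_sum_filter_not _ _ _
  -- the junk rows: no truncation in the subtraction
  have hJsum : (∑ k ∈ J, (w k + 1 - ws)) + J.card * ws = (∑ k ∈ J, w k) + J.card := by
    have hterm : ∀ k ∈ J, (w k + 1 - ws) + ws = w k + 1 := by
      intro k hk
      have := hprem k ((hmemJ k).1 hk)
      omega
    calc (∑ k ∈ J, (w k + 1 - ws)) + J.card * ws
        = ∑ k ∈ J, ((w k + 1 - ws) + ws) := by
          rw [Finset.sum_add_distrib, Finset.sum_const, smul_eq_mul]
      _ = ∑ k ∈ J, (w k + 1) := Finset.sum_congr rfl hterm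
      _ = (∑ k ∈ J, w k) + J.card := by
          rw [Finset.sum_add_distrib, Finset.sum_const, smul_eq_mul, mul_one]
  -- the non-junk strips are at most `ws` high
  have hK'sum : ∑ k ∈ K', w k ≤ K'.card * ws := by
    have := Finset.sum_le_card_nsmul K' w ws (fun k hk => hk₀max k hk)
    simpa using this
  -- `|J| + |K'| = p` and `p ≥ 1`
  have hcard : J.card + K'.card = p := by
    have := Finset.card_filter_add_card_filter_not (s := (Finset.univ : Finset (Fin p)))
      (fun k => cap (w k) = 0)
    simpa using this
  have hp : 1 ≤ p := by
    have := hK'ne.card_pos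
    omega
  -- combine: `kap ws + |J| ≤ p * ws`
  have h3 : kap ws + J.card ≤ K'.card * ws + J.card * ws := by omega
  have h4 : K'.card * ws + J.card * ws = p * ws := by rw [← add_mul, add_comm, hcard]
  have h5 : r * (ws + 1) ≤ r * (cap ws + ws) := Nat.mul_le_mul_left r (by omega)
  have h6 : r * (ws + 1) ≤ 2 * p * ws := by
    have : 2 * kap ws ≤ 2 * (p * ws) := by omega
    calc r * (ws + 1) ≤ r * (cap ws + ws) := h5
      _ ≤ 2 * kap ws := h1
      _ ≤ 2 * (p * ws) := this
      _ = 2 * p * ws := by ring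
  -- hence `r < 2 p`
  have h7 : r < 2 * p := by
    by_contra hge'
    have hge : 2 * p ≤ r := not_lt.mp hge'
    have h8 : 2 * p * (ws + 1) ≤ r * (ws + 1) := Nat.mul_le_mul_right (ws + 1) hge
    nlinarith
  omega

end Summit.MatrixMultiplication.MatrixMultiplication.Theorems
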